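import Literature.MathematicalPhysics.QuantumLattice.HubbardAttractiveGroundStateODLRO
import Literature.MathematicalPhysics.QuantumLattice.HubbardGroundStateMultipletExpectations
import HarnessLib

/-!
# Lieb's `CuO₂` lattice: the half-filled Hubbard model on the decorated square torus is a
# ferrimagnet with an explicit `1/36` floor at every size

Topic `MathematicalPhysics/QuantumLattice` (family `hubbard`). Cell `pub/hubbard-cq`, seat
`hubbard-pc-lit-1`. HONEST FRAMING: a finite-volume KERNEL at half filling of the THREE-SITE-PER-CELL
decorated square lattice (Lieb's "`CuO` lattice", the `CuO₂`-plane geometry with the oxygen sites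
kept and nearest-neighbour Cu–O hopping only), any `U > 0`; not a statement about the one-band
square-lattice Hubbard model, about doping, or about `d`-wave pairing.

Lieb (PRL 62 (1989) 1201, the example after Theorem 2) and Tasaki (J. Phys.: Condens. Matter 10
(1998) 4353, §5.3, Fig. "CuO") single out the decorated square lattice: the copper sites form an
`L × L` square lattice (`|A| = L²`), one oxygen site sits on every bond (`|B| = 2L²`), every hopping
joins a copper to an oxygen, so the lattice is bipartite and connected with `|B| - |A| = L² = |Λ|/3`;
by Lieb's Theorem 2 the half-filled ground state has spin `S₀ = L²/2 = |Λ|/6` — ferrimagnetism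
("ferromagnetism in the broad sense", Tasaki §5.3) for every `U > 0`.

This file builds the lattice and specialises the general floors of `HubbardFerrimagneticOrder`
(Lieb 1989 / Shen–Qiu–Tian 1994) to it, with the size-independent constant `1/36`:

* `LiebLattice.graph L` — the decorated square torus on `LiebLatticeSite L = Lex (FermionTorus 2 L × Fin 3)`
  (tag `0` = copper of the cell, tags `1, 2` = the oxygens on the two bonds leaving the cell in the
  directions `e₀, e₁`); `LiebLattice.bipartite` (colour class `cuSites` = tag `0`),
  `LiebLattice.connected` (`L ≠ 0`), `card_site = 3L²`, `card_cuSites = L²`,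
  `card_cuSites_compl = 2L²`, `liebSpin_cuSites = L²/2`;
* `LiebLattice.re_expect_sum_sum_fermionSpinDot_eq` — for even `L ≠ 0`, `t ≠ 0`, `U > 0`, every
  half-filled (`N = 3L²`) ground state `ψ` has uniform spin structure factor
  `Re ⟨ψ, (Σ_{x,y} 𝐒_x·𝐒_y) ψ⟩ = (L²/2)(L²/2 + 1) ‖ψ‖²`, hence (`card_sq_le_re_expect_sum_sum_fermionSpinDot`)
  `≥ (|Λ|²/36) ‖ψ‖²` — ferromagnetic long-range order with order parameter `≥ 1/36` per site²
  uniformly in `L`;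
* `LiebLattice.card_sq_le_re_expect_stagSpinStructure` — the `S^z = 0` half-filled ground state
  (exists, unique up to a scalar) has staggered (Cu versus O) structure factor
  `Re ⟨ψ, 𝓢_A ψ⟩ ≥ (L²/2)(L²/2+1)‖ψ‖² ≥ (|Λ|²/36)‖ψ‖²` as well: ferrimagnetic long-range order at
  every even `L`, every `U > 0` (Shen–Qiu–Tian);
* `LiebLattice.card_sq_le_re_expect_eta` — the ATTRACTIVE model (`U < 0`) on the same lattice: every
  half-filled ground state `ψ` (unique, Lieb's Theorem 1) has zero-momentum `s`-wave pair structure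
  factor `Re ⟨ψ, η₀† η₀ ψ⟩ ≥ (L²/2)(L²/2+1)‖ψ‖² ≥ (|Λ|²/36)‖ψ‖²`, `η₀ = Σ_x c_{x↓} c_{x↑}` — Shen–Qiu's
  off-diagonal long-range order (Goto–Koma–Yoshida Theorem 5.1 in canonical form) with the explicit
  size-independent floor `1/36` per site² (`HubbardAttractiveGroundStateODLRO` specialised);
* `LiebLattice.projState_sign_rule`, `projState_fermionSpinDot_nonpos_of_adj`,
  `card_sq_le_re_projState_sum_sum_fermionSpinDot`, `card_sq_le_re_projState_stagSpinStructure` —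
  the same statements for the TRACIAL half-filled ground state `ω = tr(P ·)/tr P` (`P` the projection
  onto the half-filled ground multiplet; no `S^z` hypothesis): Shen–Qiu–Tian's sign rule
  `ε_u ε_v ω(𝐒_u·𝐒_v) ≥ 0` (Cu–O bonds antiferromagnetically correlated) at every `L ≥ 1`, and both
  structure factors `≥ |Λ|²/36` at every even `L` (`HubbardGroundStateSpinCorrelationSigns` specialised).

## References

* E. H. Lieb, *Two theorems on the Hubbard model*, Phys. Rev. Lett. 62 (1989) 1201 — Theorem 2 and
  the `CuO`-lattice example following it. [LiebPRL1989]
* H. Tasaki, J. Phys.: Condens. Matter 10 (1998) 4353, §5.3 ("Lieb's ferrimagnetism", the CuO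
  lattice with `L²` black and `2L²` white sites, `S_tot = L²/2`). [Tasaki1998]
* S.-Q. Shen, Z.-M. Qiu, G.-S. Tian, Phys. Rev. Lett. 72 (1994) 1280. [ShenQiuTian1994]
* S.-Q. Shen, Z.-M. Qiu, Phys. Rev. Lett. 71 (1993) 4238 (ODLRO of the attractive model on Lieb
  lattices). [ShenQiu1993]
* Y. Goto, T. Koma, H. Yoshida, arXiv:2509.19780, Phys. Scr. 101 (2026) 325218, Theorem 5.1 and
  eq. (5.9) ("Lieb lattice such that `|Λ_A| - |Λ_B| = a₀|Λ|`"; here `a₀ = 1/3`). [GotoKomaYoshida2025]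
-/

noncomputable section

namespace Literature.MathematicalPhysics.QuantumLattice

open Matrix Finset LiebThm1 LiebTwo FermionSpinMoment HubbardWave0 Literature.Probability.LatticeModels
open scoped ComplexOrder

/-- The site set of Lieb's decorated square torus (`CuO₂` geometry): a cell index in the fermionic
torus `(ℤ/Lℤ)²` times a tag in `Fin 3` (`0` = Cu, `1` = O on the `e₀`-bond, `2` = O on the
`e₁`-bond), with the lexicographic linear order needed by the Jordan–Wigner construction.
[cite: LiebPRL1989, Theorem 2] [cite: Tasaki1998, §5.3] -/
abbrev LiebLatticeSite (L : ℕ) : Type := Lex (FermionTorus 2 L × Fin 3)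

namespace LiebLattice

variable {L : ℕ}

/-- The tag of a site (`0` = copper, `k+1` = oxygen in direction `k`). [cite: Tasaki1998, §5.3] -/
def tag (u : LiebLatticeSite L) : Fin 3 := (ofLex u).2

/-- The cell of a site, as a point of the torus `(ℤ/Lℤ)²`. [cite: Tasaki1998, §5.3] -/
def cell (u : LiebLatticeSite L) : TorusSite 2 L := FermionTorus.toTorusSite (ofLex u).1

/-- The copper site of the cell `p`. [cite: Tasaki1998, §5.3] -/
def cu [NeZero L] (p : TorusSite 2 L) : LiebLatticeSite L := toLex (FermionTorus.ofTorusSite p, 0)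

/-- The oxygen site on the bond leaving the cell `p` in direction `k`. [cite: Tasaki1998, §5.3] -/
def ox [NeZero L] (p : TorusSite 2 L) (k : Fin 2) : LiebLatticeSite L :=
  toLex (FermionTorus.ofTorusSite p, k.succ)

/-- The Cu–O bond relation: the copper of cell `x` is bonded to the direction-`k` oxygen of cell `y`
iff `x = y` or `x = y + e_k`. [cite: LiebPRL1989, Theorem 2] [cite: Tasaki1998, §5.3] -/
def bond (u v : LiebLatticeSite L) : Prop :=
  tag u = 0 ∧ ∃ k : Fin 2, tag v = k.succ ∧ (cell u = cell v ∨ cell u = cell v + Pi.single k 1)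

/-- A bond joins a copper (tag `0`) to an oxygen (tag `≠ 0`). [cite: Tasaki1998, §5.3] -/
theorem bond_tag {u v : LiebLatticeSite L} (h : bond u v) : tag u = 0 ∧ tag v ≠ 0 := by
  obtain ⟨h0, k, hk, -⟩ := h
  exact ⟨h0, by rw [hk]; exact Fin.succ_ne_zero k⟩

/-- **Lieb's decorated square lattice** (the `CuO₂` torus) as a simple graph: nearest-neighbour
Cu–O bonds only (the symmetrised bond relation). [cite: LiebPRL1989, Theorem 2] [cite: Tasaki1998, §5.3] -/
def graph (L : ℕ) : SimpleGraph (LiebLatticeSite L) := SimpleGraph.fromRel bond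

/-- Adjacency unfolded. [cite: Tasaki1998, §5.3] -/
theorem graph_adj (u v : LiebLatticeSite L) : (graph L).Adj u v ↔ u ≠ v ∧ (bond u v ∨ bond v u) :=
  SimpleGraph.fromRel_adj _ _ _

/-- Adjacent sites are joined by a bond in one direction. [cite: Tasaki1998, §5.3] -/
theorem bond_or_bond_of_adj {u v : LiebLatticeSite L} (h : (graph L).Adj u v) : bond u v ∨ bond v u :=
  ((graph_adj u v).1 h).2

/-- The copper sublattice `A = {tag = 0}`. [cite: LiebPRL1989, Theorem 2] -/
def cuSites (L : ℕ) : Finset (LiebLatticeSite L) := univ.filter fun u => tag u = 0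

/-- Membership in the copper sublattice. [cite: LiebPRL1989, Theorem 2] -/
theorem mem_cuSites {u : LiebLatticeSite L} : u ∈ cuSites L ↔ tag u = 0 := by
  simp [cuSites]

/-- **The decorated square lattice is bipartite** with colour class the copper sites: every bond
joins `A` to `Aᶜ`. [cite: LiebPRL1989, Theorem 2] [cite: Tasaki1998, §5.3] -/
theorem bipartite : ∀ u v : LiebLatticeSite L, (graph L).Adj u v → (u ∈ cuSites L ↔ v ∉ cuSites L) := by
  intro u v h
  rw [mem_cuSites, mem_cuSites]
  rcases bond_or_bond_of_adj h with h | h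
  · obtain ⟨hu, hv⟩ := bond_tag h
    exact ⟨fun _ => hv, fun _ => hu⟩
  · obtain ⟨hv, hu⟩ := bond_tag h
    exact ⟨fun h' => absurd h' hu, fun h' => absurd hv h'⟩

section Geometry

variable [NeZero L]

/-- `tag (cu p) = 0`. [cite: Tasaki1998, §5.3] -/
@[simp] theorem tag_cu (p : TorusSite 2 L) : tag (cu p) = 0 := by simp [tag, cu]

/-- `tag (ox p k) = k + 1`. [cite: Tasaki1998, §5.3] -/
@[simp] theorem tag_ox (p : TorusSite 2 L) (k : Fin 2) : tag (ox p k) = k.succ := by simp [tag, ox]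

/-- `cell (cu p) = p`. [cite: Tasaki1998, §5.3] -/
@[simp] theorem cell_cu (p : TorusSite 2 L) : cell (cu p) = p := by simp [cell, cu]

/-- `cell (ox p k) = p`. [cite: Tasaki1998, §5.3] -/
@[simp] theorem cell_ox (p : TorusSite 2 L) (k : Fin 2) : cell (ox p k) = p := by simp [cell, ox]

/-- A copper is not an oxygen. [cite: Tasaki1998, §5.3] -/
theorem cu_ne_ox (p q : TorusSite 2 L) (k : Fin 2) : cu p ≠ ox q k := by
  intro h
  have h' := congrArg tag h
  rw [tag_cu, tag_ox] at h'
  exact Fin.succ_ne_zero k h'.symm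

/-- `Cu(p) ∼ O_k(p)`. [cite: Tasaki1998, §5.3] -/
theorem adj_cu_ox (p : TorusSite 2 L) (k : Fin 2) : (graph L).Adj (cu p) (ox p k) :=
  (graph_adj _ _).2 ⟨cu_ne_ox p p k, Or.inl ⟨tag_cu p, k, tag_ox p k, Or.inl (by rw [cell_cu, cell_ox])⟩⟩

/-- `Cu(p + e_k) ∼ O_k(p)`. [cite: Tasaki1998, §5.3] -/
theorem adj_cu_add_ox (p : TorusSite 2 L) (k : Fin 2) :
    (graph L).Adj (cu (p + Pi.single k 1)) (ox p k) :=
  (graph_adj _ _).2 ⟨cu_ne_ox _ p k,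
    Or.inl ⟨tag_cu _, k, tag_ox p k, Or.inr (by rw [cell_cu, cell_ox])⟩⟩

/-- Every site is a copper or an oxygen of its cell. [cite: Tasaki1998, §5.3] -/
theorem eq_cu_or_eq_ox (u : LiebLatticeSite L) : u = cu (cell u) ∨ ∃ k : Fin 2, u = ox (cell u) k := by
  have hu : u = toLex ((ofLex u).1, (ofLex u).2) := by simp
  rcases Fin.eq_zero_or_eq_succ (ofLex u).2 with h | ⟨k, hk⟩
  · left
    rw [cu, cell, FermionTorus.ofTorusSite_toTorusSite, ← h]
    exact hu
  · right
    refine ⟨k, ?_⟩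
    rw [ox, cell, FermionTorus.ofTorusSite_toTorusSite, ← hk]
    exact hu

/-- One lattice step between coppers: `Cu(p) → O_k(p) → Cu(p + e_k)`. [cite: Tasaki1998, §5.3] -/
theorem reachable_cu_add_single (p : TorusSite 2 L) (k : Fin 2) :
    (graph L).Reachable (cu p) (cu (p + Pi.single k 1)) :=
  (adj_cu_ox p k).reachable.trans (adj_cu_add_ox p k).symm.reachable

/-- `n` lattice steps in direction `k`. [folklore] -/
private theorem reachable_cu_add_natCast (p : TorusSite 2 L) (k : Fin 2) :
    ∀ n : ℕ, (graph L).Reachable (cu p) (cu (p + Pi.single k (n : ZMod L)))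
  | 0 => by rw [Nat.cast_zero, Pi.single_zero, add_zero]
  | n + 1 => by
      refine (reachable_cu_add_natCast p k n).trans ?_
      have h := reachable_cu_add_single (L := L) (p + Pi.single k (n : ZMod L)) k
      rwa [add_assoc, ← Pi.single_add, ← Nat.cast_succ] at h

/-- Any two coppers are connected. [folklore] -/
private theorem reachable_cu_cu (p q : TorusSite 2 L) : (graph L).Reachable (cu p) (cu q) := by
  have hq : q = p + Pi.single 0 (((q - p) 0).val : ZMod L) + Pi.single 1 (((q - p) 1).val : ZMod L) := by
    rw [ZMod.natCast_zmod_val, ZMod.natCast_zmod_val, add_assoc]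
    have h : (Pi.single 0 ((q - p) 0) : TorusSite 2 L) + Pi.single 1 ((q - p) 1) = q - p := by
      ext i
      fin_cases i <;> simp
    rw [h]
    abel
  rw [hq]
  exact (reachable_cu_add_natCast p 0 _).trans (reachable_cu_add_natCast _ 1 _)

/-- Every site is reachable from every copper. [folklore] -/
private theorem reachable_cu (p : TorusSite 2 L) (u : LiebLatticeSite L) : (graph L).Reachable (cu p) u := by
  rcases eq_cu_or_eq_ox u with h | ⟨k, h⟩
  · rw [h]; exact reachable_cu_cu p (cell u)
  · rw [h]; exact (reachable_cu_cu p (cell u)).trans (adj_cu_ox (cell u) k).reachable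

variable (L) in
/-- **The decorated square torus is connected** (`L ≠ 0`). [cite: LiebPRL1989, Theorem 2] -/
theorem connected : (graph L).Connected :=
  (SimpleGraph.connected_iff_exists_forall_reachable _).2 ⟨cu 0, reachable_cu 0⟩

variable (L) in
/-- The copper sublattice is the image of the cells under `cu`. [cite: Tasaki1998, §5.3] -/
theorem cuSites_eq_image : cuSites L = univ.image (cu : TorusSite 2 L → LiebLatticeSite L) := by
  ext u
  rw [mem_cuSites, mem_image]
  constructor
  · intro h
    refine ⟨cell u, mem_univ _, ?_⟩
    rcases eq_cu_or_eq_ox u with h' | ⟨k, h'⟩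
    · exact h'.symm
    · rw [h', tag_ox] at h; exact absurd h (Fin.succ_ne_zero k)
  · rintro ⟨p, -, rfl⟩; exact tag_cu p

/-- `cu` is injective. [folklore] -/
private theorem cu_injective : Function.Injective (cu : TorusSite 2 L → LiebLatticeSite L) := by
  intro p q h
  have := congrArg cell h
  rwa [cell_cu, cell_cu] at this

variable (L) in
/-- `|A| = L²` coppers. [cite: Tasaki1998, §5.3] -/
theorem card_cuSites : (cuSites L).card = L ^ 2 := by
  rw [cuSites_eq_image, card_image_of_injective _ cu_injective, card_univ]
  simp [TorusSite, ZMod.card]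

end Geometry

variable (L) in
/-- `|Λ| = 3L²` sites. [cite: Tasaki1998, §5.3] -/
theorem card_site : Fintype.card (LiebLatticeSite L) = 3 * L ^ 2 := by
  simp only [LiebLatticeSite, Fintype.card_lex, Fintype.card_prod, FermionTorus, Fintype.card_fun,
    Fintype.card_fin]
  ring

variable (L) in
/-- `|B| = |Aᶜ| = 2L²` oxygens (for any decidable equality used to form the complement).
[cite: Tasaki1998, §5.3] -/
theorem card_cuSites_compl [NeZero L] [DecidableEq (LiebLatticeSite L)] : (cuSites L)ᶜ.card = 2 * L ^ 2 := by
  rw [Finset.card_compl, card_site, card_cuSites]; omega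

variable (L) in
/-- **Lieb's spin of the `CuO₂` torus**: `S₀ = ||A| - |B||/2 = L²/2 = |Λ|/6`. [cite: LiebPRL1989, Theorem 2]
[cite: Tasaki1998, §5.3] -/
theorem liebSpin_cuSites [NeZero L] : liebSpin (cuSites L) = (L : ℝ) ^ 2 / 2 := by
  rw [liebSpin, card_cuSites_compl, card_cuSites]
  push_cast
  rw [show ((L : ℝ) ^ 2 - 2 * (L : ℝ) ^ 2) = -((L : ℝ) ^ 2) by ring, abs_neg, abs_of_nonneg (by positivity)]

variable (L) in
/-- `S₀(S₀+1) ≥ S₀² = |Λ|²/36` on the `CuO₂` torus. [cite: Tasaki1998, §5.3] -/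
theorem card_sq_div_le_liebSpin [NeZero L] :
    (Fintype.card (LiebLatticeSite L) : ℝ) ^ 2 / 36 ≤ liebSpin (cuSites L) * (liebSpin (cuSites L) + 1) := by
  rw [liebSpin_cuSites, card_site]
  push_cast
  nlinarith [sq_nonneg ((L : ℝ) ^ 2)]

/-- `|Λ| = 3L²` is even for even `L`. [folklore] -/
private theorem even_card_site (hL : Even L) : Even (Fintype.card (LiebLatticeSite L)) := by
  rw [card_site, Nat.even_mul, Nat.even_pow]
  exact Or.inr ⟨hL, two_ne_zero⟩

/-! ### The half-filled Hubbard model on the `CuO₂` torus: Lieb's ferrimagnet -/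

section Hubbard

variable [NeZero L] [DecidableRel (graph L).Adj]

/-- **Spin of every half-filled ground state on the `CuO₂` torus**: `S² ψ = (L²/2)(L²/2+1) ψ`
(Lieb's Theorem 2 with `S₀ = L²/2`). [cite: LiebPRL1989, Theorem 2] [cite: Tasaki1998, §5.3] -/
theorem spinSq_mulVec_of_isGroundState (hL : Even L) {t U : ℝ} (ht : t ≠ 0) (hU : 0 < U)
    {ψ : Fock (Orb (LiebLatticeSite L))}
    (hψ : IsGroundState (hamiltonian (graph L) t U) (Fintype.card (LiebLatticeSite L)) ψ) :
    spinSq *ᵥ ψ = (((L : ℝ) ^ 2 / 2 * ((L : ℝ) ^ 2 / 2 + 1) : ℝ) : ℂ) • ψ := by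
  rw [← liebSpin_cuSites L]
  exact Literature.MathematicalPhysics.QuantumLattice.spinSq_mulVec_of_isGroundState (connected L)
    (cuSites L) bipartite (even_card_site hL) ht hU hψ

/-- **Lieb's ferrimagnetism on the `CuO₂` torus — the uniform structure factor**: for even `L ≠ 0`,
`t ≠ 0`, `U > 0`, every half-filled ground state `ψ` has
`Re ⟨ψ, (Σ_{x,y} 𝐒_x·𝐒_y) ψ⟩ = (L²/2)(L²/2 + 1) ‖ψ‖²`. [cite: LiebPRL1989, Theorem 2] [cite: Tasaki1998, §5.3] -/
theorem re_expect_sum_sum_fermionSpinDot_eq (hL : Even L) {t U : ℝ} (ht : t ≠ 0) (hU : 0 < U)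
    {ψ : Fock (Orb (LiebLatticeSite L))}
    (hψ : IsGroundState (hamiltonian (graph L) t U) (Fintype.card (LiebLatticeSite L)) ψ) :
    (star ψ ⬝ᵥ ((∑ x, ∑ y, fermionSpinDot x y) *ᵥ ψ)).re =
      (L : ℝ) ^ 2 / 2 * ((L : ℝ) ^ 2 / 2 + 1) * (star ψ ⬝ᵥ ψ).re := by
  rw [← liebSpin_cuSites L]
  exact re_expect_sum_sum_fermionSpinDot_eq_of_isGroundState (connected L) (cuSites L) bipartite
    (even_card_site hL) ht hU hψ

/-- **The ferromagnetic floor `1/36` per site², uniformly in `L`**: every half-filled ground state of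
the `CuO₂` torus has `(|Λ|²/36) ‖ψ‖² ≤ Re ⟨ψ, (Σ_{x,y} 𝐒_x·𝐒_y) ψ⟩` — long-range order with
ordering wave vector `0`. [cite: LiebPRL1989, Theorem 2] [cite: Tasaki1998, §5.3] [cite: Miyao2017, Proposition 3.9] -/
theorem card_sq_le_re_expect_sum_sum_fermionSpinDot (hL : Even L) {t U : ℝ} (ht : t ≠ 0) (hU : 0 < U)
    {ψ : Fock (Orb (LiebLatticeSite L))}
    (hψ : IsGroundState (hamiltonian (graph L) t U) (Fintype.card (LiebLatticeSite L)) ψ) :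
    (Fintype.card (LiebLatticeSite L) : ℝ) ^ 2 / 36 * (star ψ ⬝ᵥ ψ).re ≤
      (star ψ ⬝ᵥ ((∑ x, ∑ y, fermionSpinDot x y) *ᵥ ψ)).re := by
  rw [re_expect_sum_sum_fermionSpinDot_eq_of_isGroundState (connected L) (cuSites L) bipartite
    (even_card_site hL) ht hU hψ]
  exact mul_le_mul_of_nonneg_right (card_sq_div_le_liebSpin L)
    (Complex.nonneg_iff.mp (dotProduct_star_self_nonneg ψ)).1

/-- **Shen–Qiu–Tian on the `CuO₂` torus — the staggered (Cu vs O) structure factor**: for THE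
half-filled ground state `ψ` with `S^z ψ = 0`,
`(L²/2)(L²/2+1) ‖ψ‖² ≤ Re ⟨ψ, 𝓢_A ψ⟩`, `𝓢_A = Σ_{x,y} ε_x ε_y 𝐒_x·𝐒_y` (`ε = +1` on Cu, `-1` on O).
[cite: ShenQiuTian1994, Theorem and eqs. (7)–(9)] [cite: Tasaki1998, §5.3] -/
theorem liebSpin_le_re_expect_stagSpinStructure (hL : Even L) {t U : ℝ} (ht : t ≠ 0) (hU : 0 < U)
    {ψ : Fock (Orb (LiebLatticeSite L))}
    (hψ : IsGroundState (hamiltonian (graph L) t U) (Fintype.card (LiebLatticeSite L)) ψ)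
    (hZ : HubbardWave0.spinZ *ᵥ ψ = 0) :
    (L : ℝ) ^ 2 / 2 * ((L : ℝ) ^ 2 / 2 + 1) * (star ψ ⬝ᵥ ψ).re ≤
      (star ψ ⬝ᵥ (stagSpinStructure (cuSites L) *ᵥ ψ)).re := by
  rw [← liebSpin_cuSites L]
  exact Literature.MathematicalPhysics.QuantumLattice.liebSpin_le_re_expect_stagSpinStructure
    (connected L) (cuSites L) bipartite (even_card_site hL) ht hU hψ hZ

/-- **The antiferromagnetic floor `1/36` per site², uniformly in `L`**: `(|Λ|²/36) ‖ψ‖² ≤ Re ⟨ψ, 𝓢_A ψ⟩`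
for THE `S^z = 0` half-filled ground state of the `CuO₂` torus — ferrimagnetic long-range order at
every even size, every `U > 0`. [cite: ShenQiuTian1994, Theorem and eqs. (7)–(9)] [cite: Miyao2017, §6.5] -/
theorem card_sq_le_re_expect_stagSpinStructure (hL : Even L) {t U : ℝ} (ht : t ≠ 0) (hU : 0 < U)
    {ψ : Fock (Orb (LiebLatticeSite L))}
    (hψ : IsGroundState (hamiltonian (graph L) t U) (Fintype.card (LiebLatticeSite L)) ψ)
    (hZ : HubbardWave0.spinZ *ᵥ ψ = 0) :
    (Fintype.card (LiebLatticeSite L) : ℝ) ^ 2 / 36 * (star ψ ⬝ᵥ ψ).re ≤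
      (star ψ ⬝ᵥ (stagSpinStructure (cuSites L) *ᵥ ψ)).re :=
  le_trans (mul_le_mul_of_nonneg_right (card_sq_div_le_liebSpin L)
    (Complex.nonneg_iff.mp (dotProduct_star_self_nonneg ψ)).1)
    (Literature.MathematicalPhysics.QuantumLattice.liebSpin_le_re_expect_stagSpinStructure
      (connected L) (cuSites L) bipartite (even_card_site hL) ht hU hψ hZ)

/-- **Existence form on the `CuO₂` torus**: there is a half-filled ground state `ψ₀` (`S^z ψ₀ = 0`,
unique up to a scalar) with both structure factors `≥ (|Λ|²/36) ‖ψ₀‖²`.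
[cite: LiebPRL1989, Theorem 2] [cite: ShenQiuTian1994, Theorem and eqs. (7)–(9)] -/
theorem exists_groundState_ferrimagnetic_floors (hL : Even L) {t U : ℝ} (ht : t ≠ 0) (hU : 0 < U) :
    ∃ ψ₀ : Fock (Orb (LiebLatticeSite L)),
      IsGroundState (hamiltonian (graph L) t U) (Fintype.card (LiebLatticeSite L)) ψ₀ ∧
      HubbardWave0.spinZ *ᵥ ψ₀ = 0 ∧
      (Fintype.card (LiebLatticeSite L) : ℝ) ^ 2 / 36 * (star ψ₀ ⬝ᵥ ψ₀).re ≤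
        (star ψ₀ ⬝ᵥ ((∑ x, ∑ y, fermionSpinDot x y) *ᵥ ψ₀)).re ∧
      (Fintype.card (LiebLatticeSite L) : ℝ) ^ 2 / 36 * (star ψ₀ ⬝ᵥ ψ₀).re ≤
        (star ψ₀ ⬝ᵥ (stagSpinStructure (cuSites L) *ᵥ ψ₀)).re := by
  obtain ⟨ψ₀, hψ₀, hZ, -⟩ := exists_szZero_groundState (connected L) (cuSites L) bipartite
    (even_card_site hL) ht hU
  exact ⟨ψ₀, hψ₀, hZ, card_sq_le_re_expect_sum_sum_fermionSpinDot hL ht hU hψ₀,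
    card_sq_le_re_expect_stagSpinStructure hL ht hU hψ₀ hZ⟩

/-! ### The attractive model on the `CuO₂` torus: Shen–Qiu's superconducting ground state -/

/-- **Positivity of the pair correlation on the `CuO₂` torus** (`U < 0`, half filling):
`⟨ψ, c†_{x↑} c†_{x↓} c_{y↓} c_{y↑} ψ⟩ ≥ 0`. [cite: GotoKomaYoshida2025, eqs. (3.14) and (5.5)] -/
theorem expect_pair_correlation_nonneg (hL : Even L) {t U : ℝ} (ht : t ≠ 0) (hU : U < 0)
    {ψ : Fock (Orb (LiebLatticeSite L))}
    (hψ : IsGroundState (hamiltonian (graph L) t U) (Fintype.card (LiebLatticeSite L)) ψ)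
    (x y : LiebLatticeSite L) :
    0 ≤ star ψ ⬝ᵥ (((creation (orb x 0) * creation (orb x 1)) *
        (annihilation (orb y 1) * annihilation (orb y 0))) *ᵥ ψ) :=
  Literature.MathematicalPhysics.QuantumLattice.expect_pair_correlation_nonneg (connected L) (cuSites L)
    bipartite (even_card_site hL) ht hU hψ x y

/-- **Shen–Qiu's ODLRO on the `CuO₂` torus**: for even `L ≠ 0`, `t ≠ 0`, `U < 0`, every half-filled
ground state `ψ` has `(L²/2)(L²/2+1) ‖ψ‖² ≤ Re ⟨ψ, η₀† η₀ ψ⟩`, `η₀ = etaLower 1 = Σ_x c_{x↓} c_{x↑}`.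
[cite: ShenQiu1993, Theorem] [cite: GotoKomaYoshida2025, Theorem 5.1 and eq. (5.9)] -/
theorem liebSpin_le_re_expect_eta (hL : Even L) {t U : ℝ} (ht : t ≠ 0) (hU : U < 0)
    {ψ : Fock (Orb (LiebLatticeSite L))}
    (hψ : IsGroundState (hamiltonian (graph L) t U) (Fintype.card (LiebLatticeSite L)) ψ) :
    (L : ℝ) ^ 2 / 2 * ((L : ℝ) ^ 2 / 2 + 1) * (star ψ ⬝ᵥ ψ).re ≤
      (star ψ ⬝ᵥ ((etaRaise (1 : LiebLatticeSite L → ℤˣ) * etaLower 1) *ᵥ ψ)).re := by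
  rw [← liebSpin_cuSites L]
  exact Literature.MathematicalPhysics.QuantumLattice.liebSpin_le_re_expect_eta (connected L) (cuSites L)
    bipartite (even_card_site hL) ht hU hψ

/-- **The superconducting floor `1/36` per site², uniformly in `L`**: on the `CuO₂` torus with
attraction `U < 0`, every half-filled ground state has `(|Λ|²/36) ‖ψ‖² ≤ Re ⟨ψ, η₀† η₀ ψ⟩`, i.e. in
Goto–Koma–Yoshida's normalisation `ω₀([O_super]† O_super) ≥ 1/36` at every even size — off-diagonal
long-range order of the on-site `s`-wave pairs. [cite: ShenQiu1993, Theorem]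
[cite: GotoKomaYoshida2025, Theorem 5.1 and eq. (5.9)] -/
theorem card_sq_le_re_expect_eta (hL : Even L) {t U : ℝ} (ht : t ≠ 0) (hU : U < 0)
    {ψ : Fock (Orb (LiebLatticeSite L))}
    (hψ : IsGroundState (hamiltonian (graph L) t U) (Fintype.card (LiebLatticeSite L)) ψ) :
    (Fintype.card (LiebLatticeSite L) : ℝ) ^ 2 / 36 * (star ψ ⬝ᵥ ψ).re ≤
      (star ψ ⬝ᵥ ((etaRaise (1 : LiebLatticeSite L → ℤˣ) * etaLower 1) *ᵥ ψ)).re :=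
  le_trans (mul_le_mul_of_nonneg_right (card_sq_div_le_liebSpin L)
    (Complex.nonneg_iff.mp (dotProduct_star_self_nonneg ψ)).1)
    (Literature.MathematicalPhysics.QuantumLattice.liebSpin_le_re_expect_eta (connected L) (cuSites L)
      bipartite (even_card_site hL) ht hU hψ)

/-- **Existence, uniqueness and the pairing floor on the `CuO₂` torus** (`U < 0`, even `L ≠ 0`,
`t ≠ 0`): the half-filled ground state exists, is unique up to a scalar, and carries the
superconducting floor `(|Λ|²/36) ‖ψ‖² ≤ Re ⟨ψ, η₀† η₀ ψ⟩`. [cite: LiebPRL1989, Theorem 1]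
[cite: ShenQiu1993, Theorem] [cite: GotoKomaYoshida2025, Theorem 5.1] -/
theorem exists_unique_groundState_pairing_floor (hL : Even L) {t U : ℝ} (ht : t ≠ 0) (hU : U < 0) :
    ∃ ψ : Fock (Orb (LiebLatticeSite L)),
      IsGroundState (hamiltonian (graph L) t U) (Fintype.card (LiebLatticeSite L)) ψ ∧
      (∀ φ, IsGroundState (hamiltonian (graph L) t U) (Fintype.card (LiebLatticeSite L)) φ →
        ∃ a : ℂ, φ = a • ψ) ∧
      (Fintype.card (LiebLatticeSite L) : ℝ) ^ 2 / 36 * (star ψ ⬝ᵥ ψ).re ≤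
        (star ψ ⬝ᵥ ((etaRaise (1 : LiebLatticeSite L → ℤˣ) * etaLower 1) *ᵥ ψ)).re := by
  obtain ⟨ψ, hψ, huniq, -⟩ :=
    Literature.MathematicalPhysics.QuantumLattice.exists_unique_groundState_pairing_floor (connected L)
      (cuSites L) bipartite (even_card_site hL) ht hU
  exact ⟨ψ, hψ, huniq, card_sq_le_re_expect_eta hL ht hU hψ⟩

/-! #### The tracial half-filled ground state of the `CuO₂` torus (no `S^z` hypothesis) -/

/-- **Shen–Qiu–Tian's sign rule on the `CuO₂` torus** (Tasaki 1998, Theorem 5.3, non-strict, in the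
tracial half-filled ground state `ω = tr(P ·)/tr P`, `P` the projection onto the half-filled ground
multiplet): `ε_u ε_v ω(𝐒_u·𝐒_v) ≥ 0`, `ε = +1` on Cu and `-1` on O sites, every `U > 0`, `t ≠ 0`,
every `L ≥ 1`. [cite: ShenQiuTian1994, Theorem and eqs. (7)–(9)] [cite: Tasaki1998, Theorem 5.3] -/
theorem projState_sign_rule {t U : ℝ} (ht : t ≠ 0) (hU : 0 < U) (u v : LiebLatticeSite L) :
    0 ≤ stagSign (cuSites L) u * stagSign (cuSites L) v *
      ((hamiltonian (graph L) t U).sectorGroundProj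
        (nParticleSubmodule (ι := Orb (LiebLatticeSite L))
          (Fintype.card (LiebLatticeSite L)))).projState (fermionSpinDot u v) :=
  HalfFilledGroundState.sign_rule (connected L) (cuSites L) bipartite ht hU u v

/-- **Cu–O bonds are antiferromagnetically correlated** in the tracial half-filled ground state of the
`CuO₂` torus: `ω(𝐒_u·𝐒_v) ≤ 0` for every bond `u ∼ v` (Tasaki 1998, §5.3: "spins on neighboring
sites have tendency to point in the opposite direction"). [cite: Tasaki1998, Theorem 5.3 and §5.3] -/
theorem projState_fermionSpinDot_nonpos_of_adj {t U : ℝ} (ht : t ≠ 0) (hU : 0 < U)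
    {u v : LiebLatticeSite L} (huv : (graph L).Adj u v) :
    ((hamiltonian (graph L) t U).sectorGroundProj
        (nParticleSubmodule (ι := Orb (LiebLatticeSite L))
          (Fintype.card (LiebLatticeSite L)))).projState (fermionSpinDot u v) ≤ 0 :=
  HalfFilledGroundState.fermionSpinDot_nonpos_of_adj (connected L) (cuSites L) bipartite ht hU huv

/-- **Cu–Cu and O–O correlations are non-negative** in the tracial half-filled ground state of the
`CuO₂` torus. [cite: Tasaki1998, Theorem 5.3] -/
theorem projState_fermionSpinDot_nonneg_of_tag_iff {t U : ℝ} (ht : t ≠ 0) (hU : 0 < U)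
    {u v : LiebLatticeSite L} (huv : tag u = 0 ↔ tag v = 0) :
    0 ≤ ((hamiltonian (graph L) t U).sectorGroundProj
        (nParticleSubmodule (ι := Orb (LiebLatticeSite L))
          (Fintype.card (LiebLatticeSite L)))).projState (fermionSpinDot u v) :=
  HalfFilledGroundState.fermionSpinDot_nonneg_of_same (connected L) (cuSites L) bipartite ht hU
    (by rw [mem_cuSites, mem_cuSites]; exact huv)

/-- **Both structure factors of the tracial ground state are `≥ |Λ|²/36`** (`L` even, `U > 0`,
`t ≠ 0`): `|Λ|²/36 ≤ Re ω(Σ_{x,y} 𝐒_x·𝐒_y)` (`= S₀(S₀+1)`, Lieb) — ferromagnetic long-range order.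
[cite: LiebPRL1989, Theorem 2] [cite: Tasaki1998, §5.3] -/
theorem card_sq_le_re_projState_sum_sum_fermionSpinDot (hL : Even L) {t U : ℝ} (ht : t ≠ 0)
    (hU : 0 < U) :
    (Fintype.card (LiebLatticeSite L) : ℝ) ^ 2 / 36 ≤
      (((hamiltonian (graph L) t U).sectorGroundProj
        (nParticleSubmodule (ι := Orb (LiebLatticeSite L))
          (Fintype.card (LiebLatticeSite L)))).projState (∑ x, ∑ y, fermionSpinDot x y)).re := by
  rw [HalfFilledGroundState.projState_sum_sum_fermionSpinDot (connected L) (cuSites L) bipartite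
    (even_card_site hL) ht hU, Complex.ofReal_re]
  exact card_sq_div_le_liebSpin L

/-- `|Λ|²/36 ≤ Re ω(𝓢_A)` (`A` = Cu sites) in the tracial half-filled ground state of the `CuO₂`
torus (`L` even): antiferromagnetic long-range order coexisting with the ferromagnetic one —
ferrimagnetism, with no `S^z` hypothesis on the state. [cite: ShenQiuTian1994, Theorem and eqs. (7)–(9)]
[cite: Tasaki1998, §5.3] -/
theorem card_sq_le_re_projState_stagSpinStructure (hL : Even L) {t U : ℝ} (ht : t ≠ 0)
    (hU : 0 < U) :
    (Fintype.card (LiebLatticeSite L) : ℝ) ^ 2 / 36 ≤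
      (((hamiltonian (graph L) t U).sectorGroundProj
        (nParticleSubmodule (ι := Orb (LiebLatticeSite L))
          (Fintype.card (LiebLatticeSite L)))).projState (stagSpinStructure (cuSites L))).re :=
  (card_sq_div_le_liebSpin L).trans
    (HalfFilledGroundState.liebSpin_le_re_projState_stagSpinStructure (connected L) (cuSites L)
      bipartite (even_card_site hL) ht hU)

/-- **Shen–Qiu–Tian's sign rule on the `CuO₂` torus for EVERY half-filled ground state**
(Tasaki 1998, Theorem 5.3, non-strict; any member of Lieb's `(L²+1)`-fold multiplet, every `L ≥ 1`,
`t ≠ 0`, `U > 0`): `ε_u ε_v Re⟨ψ, 𝐒_u·𝐒_v ψ⟩ ≥ 0`, `ε = +1` on Cu and `-1` on O sites (`𝐒_u·𝐒_v` is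
an `SU(2)` scalar, `groundState_sign_rule_spinDot`).
[cite: ShenQiuTian1994, Theorem and eqs. (7)–(9)] [cite: Tasaki1998, Theorem 5.3] -/
theorem groundState_sign_rule {t U : ℝ} (ht : t ≠ 0) (hU : 0 < U)
    {ψ : Fock (Orb (LiebLatticeSite L))}
    (hψ : IsGroundState (hamiltonian (graph L) t U) (Fintype.card (LiebLatticeSite L)) ψ)
    (u v : LiebLatticeSite L) :
    0 ≤ (stagSign (cuSites L) u * stagSign (cuSites L) v *
      (star ψ ⬝ᵥ (fermionSpinDot u v *ᵥ ψ))).re :=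
  groundState_sign_rule_spinDot (connected L) (cuSites L) bipartite ht hU hψ u v

/-- **Cu–O bonds are antiferromagnetically correlated in EVERY half-filled ground state** of the
`CuO₂` torus: `Re⟨ψ, 𝐒_u·𝐒_v ψ⟩ ≤ 0` for every bond `u ∼ v`.
[cite: Tasaki1998, Theorem 5.3 and §5.3] -/
theorem groundState_fermionSpinDot_nonpos_of_adj {t U : ℝ} (ht : t ≠ 0) (hU : 0 < U)
    {ψ : Fock (Orb (LiebLatticeSite L))}
    (hψ : IsGroundState (hamiltonian (graph L) t U) (Fintype.card (LiebLatticeSite L)) ψ)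
    {u v : LiebLatticeSite L} (huv : (graph L).Adj u v) :
    (star ψ ⬝ᵥ (fermionSpinDot u v *ᵥ ψ)).re ≤ 0 :=
  Literature.MathematicalPhysics.QuantumLattice.groundState_fermionSpinDot_nonpos_of_adj
    (connected L) (cuSites L) bipartite ht hU hψ huv

/-- **Cu–Cu and O–O correlations are non-negative in EVERY half-filled ground state** of the `CuO₂`
torus. [cite: Tasaki1998, Theorem 5.3] -/
theorem groundState_fermionSpinDot_nonneg_of_tag_iff {t U : ℝ} (ht : t ≠ 0) (hU : 0 < U)
    {ψ : Fock (Orb (LiebLatticeSite L))}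
    (hψ : IsGroundState (hamiltonian (graph L) t U) (Fintype.card (LiebLatticeSite L)) ψ)
    {u v : LiebLatticeSite L} (huv : tag u = 0 ↔ tag v = 0) :
    0 ≤ (star ψ ⬝ᵥ (fermionSpinDot u v *ᵥ ψ)).re :=
  groundState_fermionSpinDot_nonneg_of_same (connected L) (cuSites L) bipartite ht hU hψ
    (by rw [mem_cuSites, mem_cuSites]; exact huv)

/-- **The staggered (Cu vs O) structure factor of EVERY half-filled ground state** of the `CuO₂`
torus (`L` even, `t ≠ 0`, `U > 0`; no `S^z` hypothesis — every member of Lieb's multiplet):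
`(L²/2)(L²/2+1) ‖ψ‖² ≤ Re⟨ψ, 𝓢_A ψ⟩` (`𝓢_A` is an `SU(2)` scalar,
`groundState_liebSpin_le_re_expect_stagSpinStructure`).
[cite: ShenQiuTian1994, Theorem and eqs. (7)–(9)] [cite: Tasaki1998, §5.3] -/
theorem groundState_liebSpin_le_re_expect_stagSpinStructure (hL : Even L) {t U : ℝ} (ht : t ≠ 0)
    (hU : 0 < U) {ψ : Fock (Orb (LiebLatticeSite L))}
    (hψ : IsGroundState (hamiltonian (graph L) t U) (Fintype.card (LiebLatticeSite L)) ψ) :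
    (L : ℝ) ^ 2 / 2 * ((L : ℝ) ^ 2 / 2 + 1) * (star ψ ⬝ᵥ ψ).re ≤
      (star ψ ⬝ᵥ (stagSpinStructure (cuSites L) *ᵥ ψ)).re := by
  rw [← liebSpin_cuSites L]
  exact
    Literature.MathematicalPhysics.QuantumLattice.groundState_liebSpin_le_re_expect_stagSpinStructure
      (connected L) (cuSites L) bipartite (even_card_site hL) ht hU hψ

/-- **Ferrimagnetic long-range order of EVERY half-filled ground state of the `CuO₂` torus, `1/36`
per site² uniformly in `L`** (`L` even, `t ≠ 0`, `U > 0`): `(|Λ|²/36) ‖ψ‖² ≤ Re⟨ψ, 𝓢_A ψ⟩` together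
with `(|Λ|²/36) ‖ψ‖² ≤ Re⟨ψ, (Σ_{x,y} 𝐒_x·𝐒_y) ψ⟩` (`card_sq_le_re_expect_sum_sum_fermionSpinDot`) —
antiferromagnetic and ferromagnetic order coexist in every member of the multiplet.
[cite: ShenQiuTian1994, Theorem and eqs. (7)–(9)] [cite: Miyao2017, §6.5] -/
theorem groundState_card_sq_le_re_expect_stagSpinStructure (hL : Even L) {t U : ℝ} (ht : t ≠ 0)
    (hU : 0 < U) {ψ : Fock (Orb (LiebLatticeSite L))}
    (hψ : IsGroundState (hamiltonian (graph L) t U) (Fintype.card (LiebLatticeSite L)) ψ) :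
    (Fintype.card (LiebLatticeSite L) : ℝ) ^ 2 / 36 * (star ψ ⬝ᵥ ψ).re ≤
      (star ψ ⬝ᵥ (stagSpinStructure (cuSites L) *ᵥ ψ)).re :=
  le_trans (mul_le_mul_of_nonneg_right (card_sq_div_le_liebSpin L)
    (Complex.nonneg_iff.mp (dotProduct_star_self_nonneg ψ)).1)
    (Literature.MathematicalPhysics.QuantumLattice.groundState_liebSpin_le_re_expect_stagSpinStructure
        (connected L) (cuSites L) bipartite (even_card_site hL) ht hU hψ)

end Hubbard

end LiebLattice

end Literature.MathematicalPhysics.QuantumLattice
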